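import Mathlib
import Literature.NumberTheory.Transcendental.ZagierDilogarithmConjecture
import Literature.NumberTheory.Transcendental.BlochWignerDilogarithm
import Literature.NumberTheory.LFunctions.DirichletLValueBernoulli
import Summits.KontsevichZagierPeriods.KontsevichZagierPeriods.Theorems.HyperbolicBlochZagierDilogarithmConjectureStubCyclotomicIndependence
import Summits.KontsevichZagierPeriods.KontsevichZagierPeriods.Theorems.HyperbolicBlochZagierDilogarithmConjectureStubOddFourierInversion
import HarnessLib

/-!
# `ZagierDilogarithmConjecture` (stmt-KontsevichZagierPeriods-10550) — line `kummer-clausen-linearisation`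
(reshape c5, "the cyclotomic tower and the abelian sector"), stub `stub_eqZeroOfTwists`

**Vanishing Galois twists kill a primitive upper-half combination.** Let `ζ_N = e^{2πi/N}` and `D` the
Bloch–Wigner dilogarithm. If `m : ℤ/N → ℤ` is supported on the units of the open upper half
(`(c, N) = 1`, `0 < c < N/2`) and all Galois-twisted volumes vanish, `Σ_c m_c D(ζ_N^{ac}) = 0` for every
unit `a`, then `m = 0`.

This is steps (2)–(4) of c4's `stub_cyclotomicIndependence`, run from the twists directly instead of from
membership in the relator group; it is the input of the Galois descent on `μ_N` (stub
`stub_cyclotomicTorsionDescent`), where the twists come from field automorphisms rather than from relators.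

Proof. (2) Pair the twists with an odd Dirichlet character `χ` (`sum_mul_char_eq_zero_of_twists`, which uses
`Λ_N(χ⁻¹) = Σ_b χ⁻¹(b) D(ζ^b) ≠ 0`): `Σ_c m_c χ(c) = 0` for every odd `χ`. (3) The odd function
`f(u) = m_u − m_{−u}` on `(ℤ/N)ˣ` then pairs to zero with every odd character, hence vanishes
(`stub_oddFourierInversion`): `m_c = m_{−c}` for every unit `c`. (4) If `0 < c < N/2` then `−c ≡ N − c`
lies in the lower half, outside the support, so `m_c = m_{−c} = 0`.
Sorry-free; axioms ⊆ {propext, Classical.choice, Quot.sound}.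
[cite: Neumann1998, §2.1] [cite: Milnor1982, Appendix]
-/

noncomputable section

open scoped BigOperators ComplexConjugate
open Literature.NumberTheory.Transcendental

namespace Summit.KontsevichZagierPeriods.HyperbolicBloch.ZagierDilogarithmCyclotomic

open CyclotomicIndependence

/-- If `m : ℤ/N → ℤ` is supported on units and pairs to zero with every odd Dirichlet character, then its
odd part on the units vanishes: `m_u = m_{−u}` for every unit `u` (odd Fourier inversion applied to
`f(u) = m_u − m_{−u}`). [folklore] -/
theorem intCast_units_eq_neg_of_odd_pairings {N : ℕ} [NeZero N] (m : ZMod N → ℤ)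
    (hpair : ∀ χ : DirichletCharacter ℂ N, χ.Odd → ∑ c : ZMod N, (m c : ℂ) * χ c = 0)
    (u : (ZMod N)ˣ) : m (u : ZMod N) = m (-(u : ZMod N)) := by
  classical
  -- the odd function `f(u) = m_u − m_{−u}` on the units
  set f : (ZMod N)ˣ → ℂ := fun u => (m u : ℂ) - (m (↑(-u) : ZMod N) : ℂ) with hf
  have hfodd : ∀ u, f (-u) = -f u := by
    intro u
    simp only [hf, neg_neg]
    ring
  have hfpair : ∀ χ : DirichletCharacter ℂ N, χ.Odd → ∑ u : (ZMod N)ˣ, f u * χ u = 0 := by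
    intro χ hχ
    have h1 : ∑ u : (ZMod N)ˣ, (m u : ℂ) * χ u = 0 := by
      rw [sum_units_mul_char (fun c => (m c : ℂ)) χ]
      exact hpair χ hχ
    have h2 : ∑ u : (ZMod N)ˣ, (m (↑(-u) : ZMod N) : ℂ) * χ u = 0 := by
      have e : ∑ u : (ZMod N)ˣ, (m (↑(-u) : ZMod N) : ℂ) * χ u =
          ∑ u : (ZMod N)ˣ, -((m (u : ZMod N) : ℂ) * χ u) := by
        refine Fintype.sum_equiv (Equiv.neg _) _ _ fun u => ?_
        simp only [Equiv.neg_apply, Units.val_neg]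
        rw [hχ.eval_neg]
        ring
      rw [e, Finset.sum_neg_distrib, h1, neg_zero]
    simp only [hf, sub_mul, Finset.sum_sub_distrib, h1, h2, sub_zero]
  have h := stub_oddFourierInversion N f hfodd hfpair u
  simp only [hf, Units.val_neg, sub_eq_zero] at h
  exact_mod_cast h

/-- **Stub `stub_eqZeroOfTwists` (c5): vanishing Galois twists kill a primitive upper-half
combination.** If `m : ℤ/N → ℤ` is supported on the units of the open upper half and
`Σ_c m_c D(ζ_N^{ac}) = 0` for every unit `a`, then `m = 0` — steps (2)–(4) of c4's
`stub_cyclotomicIndependence` run from the twists directly (pair with odd `χ`, `Λ_N(χ̄) ≠ 0`, odd Fourier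
inversion, support). [cite: Neumann1998, §2.1] -/
theorem stub_eqZeroOfTwists :
    ∀ (N : ℕ) [NeZero N] (m : ZMod N → ℤ), (∀ c, m c ≠ 0 → IsUnit c ∧ 0 < c.val ∧ 2 * c.val < N) →
      (∀ a : (ZMod N)ˣ, ∑ c : ZMod N, (m c : ℝ) *
          blochWignerDilog (Complex.exp (2 * Real.pi * Complex.I / N) ^ ((a : ZMod N) * c).val) = 0) →
        ∀ c, m c = 0 := by
  intro N _ m hsupp htw
  classical
  -- Step 2: all odd-character pairings of `m` vanish
  have hpair : ∀ χ : DirichletCharacter ℂ N, χ.Odd → ∑ c : ZMod N, (m c : ℂ) * χ c = 0 :=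
    fun χ hχ => sum_mul_char_eq_zero_of_twists m (fun c hc => (hsupp c hc).1) htw χ hχ
  -- Steps 3–4: `m_c = m_{−c}` on units, and `−c` lies outside the support
  intro c
  by_contra hc
  obtain ⟨hcu, hc0, hc2⟩ := hsupp c hc
  have hcne : c ≠ 0 := fun h => by rw [h, ZMod.val_zero] at hc0; exact lt_irrefl 0 hc0
  -- `m_c = m_{−c}`
  have heq : m c = m (-c) := by
    have h := intCast_units_eq_neg_of_odd_pairings m hpair hcu.unit
    rwa [IsUnit.unit_spec] at h
  -- `−c` lies in the lower half, outside the support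
  have hneg : m (-c) = 0 := by
    by_contra h
    obtain ⟨-, -, h2⟩ := hsupp (-c) h
    rw [val_neg_of_ne_zero hcne] at h2
    have hlt : c.val < N := ZMod.val_lt c
    omega
  exact hc (heq.trans hneg)

end Summit.KontsevichZagierPeriods.HyperbolicBloch.ZagierDilogarithmCyclotomic

end
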